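import Summits.QuantumAdvantage.QuantumAdvantage.Theorems.SosSandwichPseudoBoundedAAClassicalCornerExponents
import Summits.QuantumAdvantage.QuantumAdvantage.Theorems.SosSandwichPseudoBoundedAAClassicalCornerQueryOSSS
import HarnessLib

/-!
# Crux `PseudoBoundedAA` (stmt-QuantumAdvantage-15237, route SosSandwich) — the classical corner's exponent question is
# EXACTLY the `L²`-OSSS inequality: under `16·Var² ≤ C₀·Σⱼ δ̄ⱼ Infⱼ` the admissible region of `R_T` is `{a ≥ 2, b ≥ 1}`

Support file (`--supports stmt-QuantumAdvantage-15237`).  `…ClassicalCornerExponents.lean` squeezed the admissible real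
exponent pairs of laws `C·Var^a/T^b ≤ maxInf` on the classical corner `R_T` between `{a ≥ 2, b ≥ 2}` (proved) and
`{a ≥ 2, b ≥ 1}` (necessary); `…ClassicalCornerQueryOSSS.lean` proved `16·Var² ≤ (Σⱼ δ̄ⱼ)·(Σⱼ δ̄ⱼ Infⱼ)` with the mixture's
query probabilities `δ̄ⱼ`.  This file records, as a CONDITIONAL closure with the hypothesis stated inline (no named fact is
created: the hypothesis is the hands' census conjecture, not a published result), that the one missing factor is the whole
story:

* **`classicalCorner_law_of_l2osss`** — if `16·Var[p]² ≤ C₀·Σⱼ δ̄ⱼ·Infⱼ[p]` for every probability mixture of decision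
  trees (the `L²`-OSSS inequality), then every law with `a ≥ 2 ∧ b ≥ 1` holds on `R_T` (`C = 16/C₀`; `Σⱼ δ̄ⱼ ≤ T`);
* **`classicalCorner_law_iff_of_l2osss`** — hence, under `L²`-OSSS, law on `R_T` `⟺ 2 ≤ a ∧ 1 ≤ b`
  (with `classicalCorner_law_only_if`), i.e. the classical corner would be settled at the conjectured sharp shape `(2,1)`.

Honest label: conditional calibration (hypothesis inline, discharged nowhere); no registered stub, crux or summit is closed.
Sources: O'Donnell–Saks–Schramm–Servedio FOCS 2005 Thm 3.2; O'Donnell 2014 §8.6; the `L²`-OSSS question is the hands'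
own (evidence CLASSICAL-CORNER-L2OSSS-15237.md on the item), not literature.
-/

set_option linter.dupNamespace false

noncomputable section

namespace Summit.QuantumAdvantage.QuantumAdvantage.Theorems.SosSandwich

open Finset Function
open Literature.Computability.Complexity Literature.Computability.QuantumComplexity

namespace ClassicalCornerCalibration

/-- **`L²`-OSSS would give every `(a ≥ 2, b ≥ 1)` law on `R_T`.** If for some `C₀ > 0` every probability mixture
`p = Σ_k w_k [t_k accepts]` of decision trees satisfies `16·Var[p]² ≤ C₀·Σⱼ δ̄ⱼ·Infⱼ[p]`
(`δ̄ⱼ = Σ_k w_k·#{x : j ∈ t_k.queries x}/2^N`), then for `a ≥ 2`, `b ≥ 1` the law `C·Var^a/T^b ≤ maxInf` holds on the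
classical corner with `C = 16/C₀` (`Σⱼ δ̄ⱼ Infⱼ ≤ (Σⱼ δ̄ⱼ)·maxInf ≤ T·maxInf`). [cite: OdonnellEtAl2005, Thm 3.2] -/
theorem classicalCorner_law_of_l2osss {C₀ : ℝ} (hC₀ : 0 < C₀)
    (hL2 : ∀ (N m : ℕ) (w : Fin m → ℝ) (t : Fin m → DecisionTree N) (p : MvPolynomial (Fin N) ℝ),
      (∀ k, 0 ≤ w k) → ∑ k, w k = 1 →
      (∀ x : Fin N → Bool, evalBool p x = ∑ k, w k * (if (t k).eval x = true then (1 : ℝ) else 0)) →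
      16 * boolVariance p ^ 2 ≤ C₀ * ∑ j, (∑ k, w k *
        (((Finset.univ.filter fun x : Fin N → Bool => j ∈ (t k).queries x).card : ℝ) / (2 : ℝ) ^ N)) *
        influence j p)
    {a b : ℝ} (ha : 2 ≤ a) (hb : 1 ≤ b) :
    ∃ C : ℝ, 0 < C ∧ ∀ (N T : ℕ) (p : MvPolynomial (Fin N) ℝ), 1 ≤ T →
      (∃ (m : ℕ) (w : Fin m → ℝ) (t : Fin m → DecisionTree N),
        (∀ k, 0 ≤ w k) ∧ ∑ k, w k = 1 ∧ (∀ k, (t k).depth ≤ T) ∧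
          ∀ x : Fin N → Bool, evalBool p x = ∑ k, w k * (if (t k).eval x = true then (1 : ℝ) else 0)) →
      0 < boolVariance p → ∃ i : Fin N, C * boolVariance p ^ a / (T : ℝ) ^ b ≤ influence i p := by
  classical
  refine ⟨16 / C₀, by positivity, ?_⟩
  intro N T p hT hmix hv
  obtain ⟨m, w, t, hw, hw1, htd, hp⟩ := hmix
  -- a coordinate of maximal influence (`N ≥ 1` since `Var > 0`)
  rcases Nat.eq_zero_or_pos N with hN0 | hNpos
  · subst hN0
    exact absurd (BooleanCorner.boolVariance_fin_zero p) (ne_of_gt hv)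
  have hne : (Finset.univ : Finset (Fin N)).Nonempty := ⟨⟨0, hNpos⟩, Finset.mem_univ _⟩
  obtain ⟨i, -, hi⟩ := Finset.exists_max_image Finset.univ (fun j => influence j p) hne
  refine ⟨i, ?_⟩
  set δ : Fin N → ℝ := fun j => ∑ k, w k *
    (((Finset.univ.filter fun x : Fin N → Bool => j ∈ (t k).queries x).card : ℝ) / (2 : ℝ) ^ N) with hδ
  have hδ0 : ∀ j, 0 ≤ δ j := fun j => Finset.sum_nonneg fun k _ => mul_nonneg (hw k) (by positivity)
  have hkey := hL2 N m w t p hw hw1 hp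
  change 16 * boolVariance p ^ 2 ≤ C₀ * ∑ j, δ j * influence j p at hkey
  -- `Σ δ_j Inf_j ≤ (Σ δ_j) · Inf_i ≤ T · Inf_i`
  have hI := influence_nonneg i p
  have hsumδ : ∑ j, δ j ≤ (T : ℝ) := by
    have h1 : ∑ j, δ j ≤ ∑ k ∈ Finset.univ, w k * ((t k).depth : ℝ) :=
      ClassicalCornerQueryOSSS.sum_queryProb_le_avgDepth Finset.univ w (fun k _ => hw k) t
    have h2 : ∑ k ∈ Finset.univ, w k * ((t k).depth : ℝ) ≤ ∑ k ∈ Finset.univ, w k * (T : ℝ) :=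
      Finset.sum_le_sum fun k _ => mul_le_mul_of_nonneg_left (by exact_mod_cast htd k) (hw k)
    rw [← Finset.sum_mul, hw1, one_mul] at h2
    exact h1.trans h2
  have hbound : ∑ j, δ j * influence j p ≤ (T : ℝ) * influence i p := by
    calc ∑ j, δ j * influence j p ≤ ∑ j, δ j * influence i p :=
          Finset.sum_le_sum fun j _ => mul_le_mul_of_nonneg_left (hi j (Finset.mem_univ _)) (hδ0 j)
      _ = (∑ j, δ j) * influence i p := by rw [Finset.sum_mul]
      _ ≤ (T : ℝ) * influence i p := mul_le_mul_of_nonneg_right hsumδ hI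
  have h16 : 16 * boolVariance p ^ 2 ≤ C₀ * ((T : ℝ) * influence i p) :=
    hkey.trans (mul_le_mul_of_nonneg_left hbound hC₀.le)
  -- exponents: `Var^a ≤ Var²`, `T^b ≥ T`
  have hpb : PseudoBounded T p := ClassicalCorner.pseudoBounded_of_mixture w hw hw1 t T htd p hp
  have hV1 : boolVariance p ≤ 1 := (boolVariance_le_quarter hpb).trans (by norm_num)
  have hT1 : (1 : ℝ) ≤ (T : ℝ) := by exact_mod_cast hT
  have hT0 : (0 : ℝ) < (T : ℝ) := by linarith
  have hVa : boolVariance p ^ a ≤ boolVariance p ^ 2 := by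
    rw [← Real.rpow_two]
    exact Real.rpow_le_rpow_of_exponent_ge hv hV1 ha
  have hTb : (T : ℝ) ≤ (T : ℝ) ^ b := by
    calc (T : ℝ) = (T : ℝ) ^ (1 : ℝ) := (Real.rpow_one _).symm
      _ ≤ (T : ℝ) ^ b := Real.rpow_le_rpow_of_exponent_le hT1 hb
  have hTb0 : 0 < (T : ℝ) ^ b := lt_of_lt_of_le hT0 hTb
  calc 16 / C₀ * boolVariance p ^ a / (T : ℝ) ^ b ≤ 16 / C₀ * boolVariance p ^ 2 / (T : ℝ) ^ b :=
        div_le_div_of_nonneg_right (mul_le_mul_of_nonneg_left hVa (by positivity)) hTb0.le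
    _ ≤ 16 / C₀ * boolVariance p ^ 2 / (T : ℝ) :=
        div_le_div_of_nonneg_left (by positivity) hT0 hTb
    _ ≤ influence i p := by
        rw [div_le_iff₀ hT0]
        have : 16 / C₀ * boolVariance p ^ 2 = (16 * boolVariance p ^ 2) / C₀ := by ring
        rw [this, div_le_iff₀ hC₀]
        linarith

/-- **Under `L²`-OSSS the classical corner is settled at `(2,1)`:** if `16·Var² ≤ C₀·Σⱼ δ̄ⱼ Infⱼ` holds for all
probability mixtures of decision trees, then a law `C·Var^a/T^b ≤ maxInf` holds on `R_T` **iff `2 ≤ a ∧ 1 ≤ b`**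
(necessity is unconditional: `classicalCorner_law_only_if`).  So the open strip `1 ≤ b < 2` of the classical corner is
exactly the `L²`-OSSS question. [cite: OdonnellEtAl2005, Thm 3.2] -/
theorem classicalCorner_law_iff_of_l2osss {C₀ : ℝ} (hC₀ : 0 < C₀)
    (hL2 : ∀ (N m : ℕ) (w : Fin m → ℝ) (t : Fin m → DecisionTree N) (p : MvPolynomial (Fin N) ℝ),
      (∀ k, 0 ≤ w k) → ∑ k, w k = 1 →
      (∀ x : Fin N → Bool, evalBool p x = ∑ k, w k * (if (t k).eval x = true then (1 : ℝ) else 0)) →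
      16 * boolVariance p ^ 2 ≤ C₀ * ∑ j, (∑ k, w k *
        (((Finset.univ.filter fun x : Fin N → Bool => j ∈ (t k).queries x).card : ℝ) / (2 : ℝ) ^ N)) *
        influence j p)
    (a b : ℝ) :
    (∃ C : ℝ, 0 < C ∧ ∀ (N T : ℕ) (p : MvPolynomial (Fin N) ℝ), 1 ≤ T →
      (∃ (m : ℕ) (w : Fin m → ℝ) (t : Fin m → DecisionTree N),
        (∀ k, 0 ≤ w k) ∧ ∑ k, w k = 1 ∧ (∀ k, (t k).depth ≤ T) ∧
          ∀ x : Fin N → Bool, evalBool p x = ∑ k, w k * (if (t k).eval x = true then (1 : ℝ) else 0)) →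
      0 < boolVariance p → ∃ i : Fin N, C * boolVariance p ^ a / (T : ℝ) ^ b ≤ influence i p) ↔
      (2 ≤ a ∧ 1 ≤ b) :=
  ⟨classicalCorner_law_only_if a b, fun h => classicalCorner_law_of_l2osss hC₀ hL2 h.1 h.2⟩

end ClassicalCornerCalibration

end Summit.QuantumAdvantage.QuantumAdvantage.Theorems.SosSandwich

end
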